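import Summits.CriticalPhenomena.SAWScalingLimit.Theorems.SAWDefectDecoherenceBoundaryClosureRPickEngineWeakDbarSum
import Summits.CriticalPhenomena.SAWScalingLimit.Theorems.SAWDefectDecoherenceBoundaryClosureRPickEngineWeakDbarLocal
import Summits.CriticalPhenomena.SAWScalingLimit.Theorems.SAWDefectDecoherenceBoundaryClosureRPickEngineRemark
import Literature.Probability.RandomPlanarGeometry.HexParafermionProofs

/-!
# Pick engine, STAGE 1 (S2): the weak `∂̄`-closure of the limit (`pickEngine_weakDbar`)

Support file for crux `BoundaryClosureR` (stmt-CriticalPhenomena-14004), line `pick-half-plane`,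
stub `stub_pickEngine`.  Discharges hypothesis (S2) of `pickEngine_stage1`: for an admissible
family pinned at a flat root `x` (root family `e`, normaliser family `b`), the route node
`ConjugateClassNegligible` (the weak vanishing of the conjugate-class sums for `C¹` tests; proved
from `DefectDecoherence` and `MassRatio` by `DecoherenceSynthesis`), the local `L¹` law at the
pinned root (the skeleton's `LocalL1Bound`, instantiated), and a weak limit `g₀` of the normalised
functionals `N_δ` along a mesh sequence `ns` for continuous compactly supported tests imply

  `∫ g₀ · ∂̄φ dA = 0`   for every smooth `φ` compactly supported in the carrier.

Mechanism (Duminil-Copin–Smirnov 2012, §3, summation by parts): DCS Lemma 1 (the vertex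
relations of the critical observable, `DuminilCopinSmirnov2012_lemma1_holds`) summed against the
weights `φ(δ c_v)` and regrouped by edges (`…PickEngineStarRegrouping`), Taylor at the scaled
midpoints with the cube identity `a³ = b³ = c³` of the honeycomb (`…PickEngineWeakDbarLocal`)
and the resulting `O(δ · mass)` bound (`…PickEngineWeakDbarSum`): along `ns`,
`(1/3) N(∂̄φ) + 3a³ · CC(∂φ) → 0`, while `N(∂̄φ) → ∫ ∂̄φ g₀` (weak limit, `∂̄φ` is a continuous
test) and `CC(∂φ) → 0` (`ConjugateClassNegligible` at the re-marked domain with first marked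
point `x`, `exists_dobrushinDomain_pt_zero_eq`, test `∂φ ∈ C¹_c`).  Hence `∫ ∂̄φ g₀ = 0`.
-/

noncomputable section

open scoped Topology ComplexConjugate ContDiff
open Filter Set Metric Complex MeasureTheory
open Literature.Probability.LatticeModels Literature.Probability.RandomPlanarGeometry
open Literature.Probability.RandomPlanarGeometry.SAW
open Literature.Barriers.CriticalPhenomena Literature.Barriers.CriticalPhenomena.HexGreen
open Literature.Barriers.CriticalPhenomena.HexKernel (vecA term)
open Literature.Analysis.Complex (dbarAlong dbarAlong_one dbarAlong_eq_zero_of_notMem_tsupport)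
open Summit.CriticalPhenomena.SAWScalingLimit.Theses.SAWDefectDecoherence

namespace Summit.CriticalPhenomena.SAWScalingLimit.Theorems.PickHalfPlane.Engine

/-- `∂̄φ` of a smooth function is continuous. [folklore] -/
theorem continuous_dbarAlong_one {φ : ℂ → ℂ} (hφ : ContDiff ℝ ∞ φ) : Continuous (dbarAlong 1 φ) := by
  have hc : Continuous (fderiv ℝ φ) := hφ.continuous_fderiv (by simp)
  have : dbarAlong 1 φ = fun z => (2 : ℂ)⁻¹ • (fderiv ℝ φ z 1 + I • fderiv ℝ φ z I) := by
    ext z; rw [dbarAlong_one]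
  rw [this]
  exact ((hc.clm_apply continuous_const).add
    ((hc.clm_apply continuous_const).const_smul I)).const_smul ((2 : ℂ)⁻¹)

/-- `∂φ = ½(φₓ - iφ_y)` of a smooth function is `C¹`. [folklore] -/
theorem contDiff_one_dAlong {φ : ℂ → ℂ} (hφ : ContDiff ℝ ∞ φ) :
    ContDiff ℝ 1 fun z => (2 : ℂ)⁻¹ * (fderiv ℝ φ z 1 - I * fderiv ℝ φ z I) := by
  have hD : ContDiff ℝ 1 (fderiv ℝ φ) := hφ.fderiv_right (by norm_cast)
  have h1 : ContDiff ℝ 1 fun z => fderiv ℝ φ z 1 :=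
    (ContinuousLinearMap.apply ℝ ℂ (1 : ℂ)).contDiff.comp hD
  have hI : ContDiff ℝ 1 fun z => fderiv ℝ φ z I :=
    (ContinuousLinearMap.apply ℝ ℂ I).contDiff.comp hD
  exact contDiff_const.mul (h1.sub (contDiff_const.mul hI))

/-- A function vanishing off a compact set has compact support contained in it (when the set is
closed). [folklore] -/
theorem tsupport_subset_of_eq_zero {ψ : ℂ → ℂ} {K : Set ℂ} (hK : IsClosed K)
    (h : ∀ z, z ∉ K → ψ z = 0) : tsupport ψ ⊆ K :=
  closure_minimal (fun z hz => by by_contra hzK; exact hz (h z hzK)) hK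

/-- **The weak `∂̄`-closure of the limit (registered sub-goal `pickEngine_weakDbar` of stub
`stub_pickEngine`; discharges (S2) of `pickEngine_stage1`).** For an admissible family pinned at a
flat root `x ≠ D.pt 1` (binders: the skeleton's `AdmissibleFamily D ρ Λ m b` and
`PinnedFlatRoot D Λ b x e r mr`, unfolded), the route's `ConjugateClassNegligible`, the local `L¹`
law at the root family `e` (the skeleton's `LocalL1Bound` instantiated), and a weak limit `g₀` of
the normalised functionals along a mesh sequence `ns → 0⁺` for continuous compactly supported
tests: `∫ g₀ ∂̄φ = 0` for every smooth `φ` compactly supported in the carrier. [folklore] -/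
theorem pickEngine_weakDbar :
    ConjugateClassNegligible →
    ∀ (D : DobrushinDomain) (ρ : ℝ) (Λ : ℝ → Finset HexVertex) (m : ℝ → ℤ)
      (b : ℝ → Sym2 HexVertex),
    (0 < ρ ∧
      D.carrier ∩ Metric.ball (D.pt 1) ρ = {z : ℂ | (D.pt 1).im < z.im} ∩ Metric.ball (D.pt 1) ρ ∧
      (∀ᶠ δ : ℝ in 𝓝[>] 0, hexDomainSimplyConnected (Λ δ) ∧ b δ ∈ hexDomainBoundary (Λ δ) ∧
        (hexGraph.induce ((Λ δ : Finset HexVertex) : Set HexVertex)).Preconnected ∧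
        (∀ v ∈ Λ δ, (δ : ℂ) * hexCenter v ∈ D.carrier) ∧
        (∀ v : HexVertex, (δ : ℂ) * hexCenter v ∈ Metric.ball (D.pt 1) ρ →
          (v ∈ Λ δ ↔ m δ ≤ v.1 1))) ∧
      (∀ K : Set ℂ, IsCompact K → K ⊆ D.carrier →
        ∀ᶠ δ : ℝ in 𝓝[>] 0, ∀ v : HexVertex, (δ : ℂ) * hexCenter v ∈ K → v ∈ Λ δ) ∧
      Tendsto (fun δ : ℝ => (δ : ℂ) * hexMidpoint (b δ)) (𝓝[>] 0) (𝓝 (D.pt 1))) →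
    ∀ (x : ℂ) (e : ℝ → Sym2 HexVertex) (r : ℝ) (mr : ℝ → ℤ),
    (0 < r ∧
      D.carrier ∩ Metric.ball x r = {z : ℂ | x.im < z.im} ∩ Metric.ball x r ∧
      (∀ᶠ δ : ℝ in 𝓝[>] 0, e δ ∈ hexDomainBoundary (Λ δ) ∧
        Nonempty (HexMidEdgeSAW (Λ δ) (e δ) (b δ)) ∧
        (∀ v : HexVertex, (δ : ℂ) * hexCenter v ∈ Metric.ball x r → (v ∈ Λ δ ↔ mr δ ≤ v.1 1))) ∧
      Tendsto (fun δ : ℝ => (δ : ℂ) * hexMidpoint (e δ)) (𝓝[>] 0) (𝓝 x)) →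
    x ≠ D.pt 1 →
    (∀ K : Set ℂ, IsCompact K → K ⊆ D.carrier → ∃ C : ℝ, ∀ᶠ δ : ℝ in 𝓝[>] 0,
      δ ^ 2 * (∑ᶠ z ∈ {z : Sym2 HexVertex | z ∈ hexDomainMidEdges (Λ δ) ∧
          (δ : ℂ) * hexMidpoint z ∈ K},
        ‖hexParafermionicObservable (Λ δ) (e δ) hexCriticalFugacity (5 / 8) z‖) ≤
      C * ‖hexParafermionicObservable (Λ δ) (e δ) hexCriticalFugacity (5 / 8) (b δ)‖) →
    ∀ (ns : ℕ → ℝ), Tendsto ns atTop (𝓝[>] 0) → ∀ (g₀ : ℂ → ℂ),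
    (∀ ψ : ℂ → ℂ, Continuous ψ → HasCompactSupport ψ → tsupport ψ ⊆ D.carrier →
      Tendsto (fun n => ((ns n : ℝ) : ℂ) ^ 2 * (∑ᶠ z ∈ hexDomainMidEdges (Λ (ns n)),
          ψ (((ns n : ℝ) : ℂ) * hexMidpoint z) *
            hexParafermionicObservable (Λ (ns n)) (e (ns n)) hexCriticalFugacity (5 / 8) z) /
        hexParafermionicObservable (Λ (ns n)) (e (ns n)) hexCriticalFugacity (5 / 8) (b (ns n)))
        atTop (𝓝 (∫ z, ψ z * g₀ z))) →
    ∀ φ : ℂ → ℂ, ContDiff ℝ ∞ φ → HasCompactSupport φ → tsupport φ ⊆ D.carrier →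
      ∫ z, g₀ z * dbarAlong 1 φ z = 0 := by
  intro hCCN D ρ Λ m b hAF x e r mr hPR hx hL1 ns hns g₀ hweak φ hφ hφc hφD
  obtain ⟨hρ, hflat1, hadm, hexh, hb⟩ := hAF
  obtain ⟨hr, hflatx, hroot, he⟩ := hPR
  set F : ℝ → Sym2 HexVertex → ℂ := fun δ z =>
    hexParafermionicObservable (Λ δ) (e δ) hexCriticalFugacity (5 / 8) z with hFdef
  ---------------------------------------------------------------- the compact `K` and its thickening
  set K : Set ℂ := tsupport φ with hKdef
  have hK : IsCompact K := hφc
  obtain ⟨ε₀, hε₀, hKε⟩ := hK.exists_cthickening_subset_open D.isOpen hφD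
  have hK' : IsCompact (Metric.cthickening ε₀ K) := hK.cthickening
  ---------------------------------------------------------------- the two derived test functions
  set ψ₁ : ℂ → ℂ := dbarAlong 1 φ with hψ₁
  set ψ₂ : ℂ → ℂ := fun z => (2 : ℂ)⁻¹ * (fderiv ℝ φ z 1 - I * fderiv ℝ φ z I) with hψ₂
  have hfdK : ∀ z, z ∉ K → fderiv ℝ φ z = 0 := fun z hz => by
    by_contra hne; exact hz (support_fderiv_subset ℝ (Function.mem_support.2 hne))
  have hψ₁K : ∀ z, z ∉ K → ψ₁ z = 0 := fun z hz => dbarAlong_eq_zero_of_notMem_tsupport hz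
  have hψ₂K : ∀ z, z ∉ K → ψ₂ z = 0 := fun z hz => by simp [hψ₂, hfdK z hz]
  have hψ₁c : Continuous ψ₁ := continuous_dbarAlong_one hφ
  have hψ₁cs : HasCompactSupport ψ₁ := HasCompactSupport.intro hK hψ₁K
  have hψ₁s : tsupport ψ₁ ⊆ D.carrier := (tsupport_subset_of_eq_zero hK.isClosed hψ₁K).trans hφD
  have hψ₂d : ContDiff ℝ 1 ψ₂ := contDiff_one_dAlong hφ
  have hψ₂cs : HasCompactSupport ψ₂ := HasCompactSupport.intro hK hψ₂K
  have hψ₂s : tsupport ψ₂ ⊆ D.carrier := (tsupport_subset_of_eq_zero hK.isClosed hψ₂K).trans hφD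
  ---------------------------------------------------------------- the three limits along `ns`
  -- (1) the weak limit at the continuous test `∂̄φ`
  have hN := hweak ψ₁ hψ₁c hψ₁cs hψ₁s
  -- (2) the conjugate-class sum at `∂φ`, through the re-marked domain
  obtain ⟨hxfr, -⟩ := mem_frontier_of_flat_piece D hr hflatx
  obtain ⟨D', hcar, h0, h1⟩ := exists_dobrushinDomain_pt_zero_eq D hxfr hx
  have hadm' : ∀ᶠ δ : ℝ in 𝓝[>] 0, hexDomainSimplyConnected (Λ δ) ∧
      e δ ∈ hexDomainBoundary (Λ δ) ∧ b δ ∈ hexDomainBoundary (Λ δ) ∧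
      Nonempty (HexMidEdgeSAW (Λ δ) (e δ) (b δ)) ∧
      (hexGraph.induce ((Λ δ : Finset HexVertex) : Set HexVertex)).Preconnected ∧
      (∀ v ∈ Λ δ, (δ : ℂ) * hexCenter v ∈ D'.carrier) ∧
      (∀ v : HexVertex, (δ : ℂ) * hexCenter v ∈ Metric.ball (D'.pt 1) ρ →
        (v ∈ Λ δ ↔ m δ ≤ v.1 1)) := by
    filter_upwards [hadm, hroot] with δ hδ hδ'
    rw [hcar, h1]
    exact ⟨hδ.1, hδ'.1, hδ.2.1, hδ'.2.1, hδ.2.2.1, hδ.2.2.2.1, hδ.2.2.2.2⟩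
  have hflat1' : D'.carrier ∩ Metric.ball (D'.pt 1) ρ =
      {z : ℂ | (D'.pt 1).im < z.im} ∩ Metric.ball (D'.pt 1) ρ := by rw [hcar, h1]; exact hflat1
  have hexh' : ∀ K : Set ℂ, IsCompact K → K ⊆ D'.carrier →
      ∀ᶠ δ : ℝ in 𝓝[>] 0, ∀ v : HexVertex, (δ : ℂ) * hexCenter v ∈ K → v ∈ Λ δ := by
    rw [hcar]; exact hexh
  have he' : Tendsto (fun δ : ℝ => (δ : ℂ) * hexMidpoint (e δ)) (𝓝[>] 0) (𝓝 (D'.pt 0)) := by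
    rw [h0]; exact he
  have hb' : Tendsto (fun δ : ℝ => (δ : ℂ) * hexMidpoint (b δ)) (𝓝[>] 0) (𝓝 (D'.pt 1)) := by
    rw [h1]; exact hb
  have hψ₂s' : tsupport ψ₂ ⊆ D'.carrier := by rw [hcar]; exact hψ₂s
  have hCC0 := hCCN D' ρ Λ m e b ψ₂ hρ hflat1' hadm' hexh' he' hb' hψ₂d hψ₂cs hψ₂s'
  have hCC : Tendsto (fun n => ((ns n : ℝ) : ℂ) ^ 2 *
      (∑ᶠ p ∈ {p : HexVertex × HexVertex | s(p.1, p.2) ∈ hexDomainMidEdges (Λ (ns n)) ∧ p.1.2 = 0},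
        ψ₂ (((ns n : ℝ) : ℂ) * hexMidpoint s(p.1, p.2)) * conj (hexCenter p.2 - hexCenter p.1) *
          F (ns n) s(p.1, p.2)) / F (ns n) (b (ns n))) atTop (𝓝 0) := hCC0.comp hns
  -- (3) the remainder: `O(ns n)` eventually
  have hφ2 : ContDiff ℝ 2 φ := hφ.of_le (by
    change ((2 : ℕ∞) : WithTop ℕ∞) ≤ ((⊤ : ℕ∞) : WithTop ℕ∞)
    exact WithTop.coe_le_coe.2 le_top)
  obtain ⟨C, hC0, hedge⟩ := pickEngine_edgeTaylor φ hφ2 hφc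
  obtain ⟨C₁, hC₁⟩ := hL1 (Metric.cthickening ε₀ K) hK' hKε
  have hev : ∀ᶠ δ : ℝ in 𝓝[>] 0,
      ‖(1 / 3 : ℂ) * ((δ : ℂ) ^ 2 * (∑ᶠ z ∈ hexDomainMidEdges (Λ δ),
          ψ₁ ((δ : ℂ) * hexMidpoint z) * F δ z) / F δ (b δ)) +
        3 * vecA ^ 3 * ((δ : ℂ) ^ 2 * (∑ᶠ p ∈ {p : HexVertex × HexVertex |
            s(p.1, p.2) ∈ hexDomainMidEdges (Λ δ) ∧ p.1.2 = 0},
          ψ₂ ((δ : ℂ) * hexMidpoint s(p.1, p.2)) * conj (hexCenter p.2 - hexCenter p.1) *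
            F δ s(p.1, p.2)) / F δ (b δ))‖ ≤ 2 * C * (max C₁ 0) * δ := by
    have hsmall : ∀ᶠ δ : ℝ in 𝓝[>] 0, δ < ε₀ := by
      have : Iio ε₀ ∈ 𝓝 (0 : ℝ) := Iio_mem_nhds hε₀
      exact mem_nhdsWithin_of_mem_nhds this
    have hpos : ∀ᶠ δ : ℝ in 𝓝[>] 0, 0 < δ := self_mem_nhdsWithin
    filter_upwards [hpos, hsmall, hadm, hroot, hexh _ hK' hKε, hC₁] with δ hδ hδε hδadm hδroot hδexh hδL1
    have hVR : SatisfiesVertexRelations (Λ δ) (F δ) :=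
      (lemma1_iff.1 DuminilCopinSmirnov2012_lemma1_holds) (Λ δ) hδadm.1 (e δ) hδroot.1
    have hbound := pickEngine_weakDbarBound (Λ δ) (F δ) (b δ) φ K C δ ε₀ hVR subset_rfl hC0 hδ
      hδε.le hδexh (fun v w hv hw => hedge δ (F δ) v w hv hw)
    refine hbound.trans ?_
    -- `δ² · mass / ‖F b‖ ≤ max C₁ 0`
    have hmass : δ ^ 2 * (∑ᶠ z ∈ {z : Sym2 HexVertex | z ∈ hexDomainMidEdges (Λ δ) ∧
        (δ : ℂ) * hexMidpoint z ∈ Metric.cthickening ε₀ K}, ‖F δ z‖) / ‖F δ (b δ)‖ ≤ max C₁ 0 := by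
      by_cases hFb : ‖F δ (b δ)‖ = 0
      · rw [hFb, div_zero]; exact le_max_right _ _
      · rw [div_le_iff₀ (lt_of_le_of_ne (norm_nonneg _) (Ne.symm hFb))]
        exact hδL1.trans (mul_le_mul_of_nonneg_right (le_max_left _ _) (norm_nonneg _))
    calc 2 * C * δ * (δ ^ 2 * (∑ᶠ z ∈ {z : Sym2 HexVertex | z ∈ hexDomainMidEdges (Λ δ) ∧
          (δ : ℂ) * hexMidpoint z ∈ Metric.cthickening ε₀ K}, ‖F δ z‖) / ‖F δ (b δ)‖)
        ≤ 2 * C * δ * max C₁ 0 := mul_le_mul_of_nonneg_left hmass (by positivity)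
      _ = 2 * C * max C₁ 0 * δ := by ring
  -- along `ns`: the combination tends to `0`
  set Q : ℕ → ℂ := fun n => (1 / 3 : ℂ) * (((ns n : ℝ) : ℂ) ^ 2 *
      (∑ᶠ z ∈ hexDomainMidEdges (Λ (ns n)), ψ₁ (((ns n : ℝ) : ℂ) * hexMidpoint z) * F (ns n) z) /
        F (ns n) (b (ns n))) +
    3 * vecA ^ 3 * (((ns n : ℝ) : ℂ) ^ 2 * (∑ᶠ p ∈ {p : HexVertex × HexVertex |
        s(p.1, p.2) ∈ hexDomainMidEdges (Λ (ns n)) ∧ p.1.2 = 0},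
      ψ₂ (((ns n : ℝ) : ℂ) * hexMidpoint s(p.1, p.2)) * conj (hexCenter p.2 - hexCenter p.1) *
        F (ns n) s(p.1, p.2)) / F (ns n) (b (ns n))) with hQ
  have hQ0 : Tendsto Q atTop (𝓝 0) := by
    rw [tendsto_zero_iff_norm_tendsto_zero]
    have hns0 : Tendsto ns atTop (𝓝 0) := hns.mono_right nhdsWithin_le_nhds
    have hmaj : Tendsto (fun n => 2 * C * max C₁ 0 * ns n) atTop (𝓝 0) := by
      simpa using hns0.const_mul (2 * C * max C₁ 0)
    refine squeeze_zero' (Eventually.of_forall fun n => norm_nonneg _) ?_ hmaj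
    exact hns.eventually hev
  -- and to `(1/3) ∫ ∂̄φ g₀ + 3a³ · 0`
  have hQ1 : Tendsto Q atTop (𝓝 ((1 / 3 : ℂ) * (∫ z, ψ₁ z * g₀ z) + 3 * vecA ^ 3 * 0)) :=
    (hN.const_mul (1 / 3 : ℂ)).add (hCC.const_mul (3 * vecA ^ 3))
  have hlim := tendsto_nhds_unique hQ1 hQ0
  rw [mul_zero, add_zero, mul_eq_zero] at hlim
  rcases hlim with h3 | hI
  · norm_num at h3
  · rw [← hI]
    refine integral_congr_ae (Eventually.of_forall fun z => ?_)
    show g₀ z * dbarAlong 1 φ z = ψ₁ z * g₀ z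
    rw [hψ₁, mul_comm]

end Summit.CriticalPhenomena.SAWScalingLimit.Theorems.PickHalfPlane.Engine

end
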